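import Summits.BirchSwinnertonDyer.BirchSwinnertonDyer.Theorems.PrintCf2SplitBadTwoSplitPrimeLineSaturationAnyP
import Literature.NumberTheory.EllipticCurves.ZpExtensionSplitPrimeLineThroughPair
import HarnessLib

/-!
# Line `thin_comb` (v2) on the WALL `AdditiveSplitIMCInclusionAtThree` (stmt-BirchSwinnertonDyer-20395) — stub
# `stub_frame` (v2) CLOSED (`--supports stmt-BirchSwinnertonDyer-20395`; cell `pub/bsd-wall`, lead `cruxlead-20395` g3)

The registered skeleton v2 `Cruxes/AdditiveSplitIMCInclusionAtThree/Lines/thin_comb.lean` (sha16 76d3467012f0f2fc) has the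
support stub `stub_frame`: for `K` imaginary quadratic, `κ` an anticyclotomic `ℤ₃`-extension with topological generator
`γ`, and two distinct places `𝔭 ≠ 𝔭′` of `K` above `3`, there is a 𝔭-ADAPTED NORMALISED FRAME of the `ℤ₃²`-tower: a
generator pair `(κ₁, κ₂; γ₁, γ₂)` with `κ₁` unramified outside `𝔭` (every inertia group above every `v ≠ 𝔭` lies in
`ker κ₁`), `ker κ₁ ∩ ker κ₂ ≤ ker κ`, `κ(γ₁) = κ(γ) = 1` and `κ(γ₂) = 3^k` for some `k : ℕ`.

Proof (`ℤ_p`-linear algebra on class field theory already PROVED in the tree; stated for every odd prime `p`,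
`exists_adaptedNormalisedFrame`):
* `κ₀ :=` THE `ℤ_p`-extension unramified outside `𝔭` (`ZpExtension.exists_isUnramifiedOutside_of_split`); it kills every
  inertia group above every `v ≠ 𝔭` (`PrintCf2.SplitPrimeLine.inertia_le_kerSubgroup_of_isUnramifiedOutside`);
* complete `κ₀` to a generator pair `(κ₀, κ₀′; δ₀, δ₀′)` (`PrintCf2.GeneratorPairSupply.exists_isTopGeneratorPair_of_isTopGenerator_of_isImaginaryQuadratic`)
  and write `κ = a κ₀ + b κ₀′` (`…exists_coeff_of_isTopGeneratorPair_of_isImaginaryQuadratic`); every `ℤ_p`-extension is a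
  line of the presented tower (`…pairKer_le_kerSubgroup`);
* `b ≠ 0`: the anticyclotomic `κ` is ramified above `𝔭′` (Brink: `ZpExtension.exists_mem_inertia_apply_ne_one_of_isAnticyclotomic`)
  while `κ₀` is not; write `b = u·p^k`, `u ∈ ℤ_pˣ` (`PadicInt.unitCoeff_spec`);
* if `b` is a unit: `κ₁ := κ₀`, `κ₂ := (a − 1)κ₀ + bκ₀′ = κ − κ₀` (`ZpExtension.ofLinComb`), `γ₁ ↔ (1, b⁻¹(1 − a))`,
  `γ₂ ↔ (0, b⁻¹)` (joint surjectivity `TwoVariableSelmer.exists_apply_eq_of_isTopGeneratorPair`), `k = 0`;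
* if `b` is not a unit then `a` is (`κ γ = 1` in the local ring `ℤ_p`): `κ₁ := a·κ₀`, `κ₂ := u·κ₀′` (unit twists),
  `γ₁ ↔ (a⁻¹, 0)`, `γ₂ ↔ (0, u⁻¹)`, so that `κ = κ₁ + p^k κ₂` on the new pair.

No condition on `κ₂` is asserted (v1's «`κ₂` unramified outside `𝔭′` ∧ `κ(γ₂) = 1`» is false when the first
anticyclotomic layer is unramified, e.g. `K = ℚ(√−23)`, `p = 3` — `Cruxes/AdditiveSplitIMCInclusionAtThree/THIN-COMB-V2-NOTE.md`).
Nothing else of the line is addressed; BSD is not proved by any of this.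

References: [deShalit1987] II.1.9, II.4.17 (p. 77); [Greenberg1978] §4 p. 94; [Washington1997] §13.1, Prop. 13.2, Thm. 13.4;
[Brink2007] §II Prop. 1, Cor. 1 (p. 2136).
-/

set_option linter.dupNamespace false
set_option autoImplicit false

noncomputable section

namespace Summit.BirchSwinnertonDyer.BirchSwinnertonDyer.Theorems.UniversalToricDescentThinCombLine

open NumberField IsDedekindDomain Field
open Literature.NumberTheory.GaloisRepresentations Literature.NumberTheory.EllipticCurves
open Summit.BirchSwinnertonDyer.BirchSwinnertonDyer.Theorems.PrintCf2

variable {p : ℕ} [Fact p.Prime] {K : Type} [Field K]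

/-- `σ τ⁻¹ ∈ ker κ` iff `κ σ = κ τ` (additive coordinates). [cite: Washington1997, §13.1] -/
theorem mul_inv_mem_kerSubgroup_iff (κ : ZpExtension K p) (σ τ : absoluteGaloisGroup K) :
    σ * τ⁻¹ ∈ κ.kerSubgroup ↔ (κ σ).toAdd = (κ τ).toAdd := by
  rw [ZpExtension.mem_kerSubgroup, map_mul, map_inv, mul_inv_eq_one]
  exact ⟨fun h ↦ by rw [h], fun h ↦ Multiplicative.toAdd.injective h⟩

/-- `κ(γ^{p^k}) = p^k` in `ℤ_p` for a topological generator `γ` (`κ γ = 1`). [cite: Washington1997, §13.1] -/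
theorem toAdd_apply_pow_of_isTopGenerator {κ : ZpExtension K p} {γ : absoluteGaloisGroup K}
    (hγ : κ.IsTopGenerator γ) (k : ℕ) : (κ (γ ^ (p ^ k))).toAdd = (p : ℤ_[p]) ^ k := by
  rw [map_pow, toAdd_pow, show κ γ = Multiplicative.ofAdd 1 from hγ, toAdd_ofAdd, nsmul_eq_mul, mul_one,
    Nat.cast_pow]

variable [NumberField K]

/-- **The 𝔭-adapted normalised frame of the `ℤ_p²`-tower, every odd prime `p`.** For `K` imaginary quadratic,
`p = 𝔭𝔭′` split (`𝔭′ ≠ 𝔭` above `p`), `κ` an anticyclotomic `ℤ_p`-extension with topological generator `γ`: there is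
a generator pair `(κ₁, κ₂; γ₁, γ₂)` of `ℤ_p`-quotients of `Γ_K` with `κ₁` unramified outside `𝔭` (every inertia group of
`\bar ℤ_K` above every finite place `v ≠ 𝔭` lies in `ker κ₁` — so `γ₂` spans the saturated `𝔭′`-inertia line),
`ker κ₁ ∩ ker κ₂ ≤ ker κ`, `κ γ₁ = κ γ` and `κ γ₂ = κ (γ^{p^k})` for some `k : ℕ` (i.e. `κ = κ₁ + p^k κ₂` in the pair's
coordinates). `k = 0` unless the anticyclotomic line and the `𝔭`-line share their first layer.
[cite: deShalit1987, II.4.17 (p. 77)] [cite: Greenberg1978, §4 p. 94] [cite: Washington1997, §13.1, Thm. 13.4]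
[cite: Brink2007, Cor. 1 (p. 2136)] -/
theorem exists_adaptedNormalisedFrame (hK : IsImaginaryQuadratic K) (hp2 : p ≠ 2)
    {κ : ZpExtension K p} (hκ : κ.IsAnticyclotomic) {γ : absoluteGaloisGroup K} (hγ : κ.IsTopGenerator γ)
    {𝔭 𝔭' : HeightOneSpectrum (𝓞 K)} (h𝔭 : ((p : ℕ) : 𝓞 K) ∈ 𝔭.asIdeal)
    (h𝔭' : ((p : ℕ) : 𝓞 K) ∈ 𝔭'.asIdeal) (hne : 𝔭' ≠ 𝔭) :
    ∃ (κ₁ κ₂ : ZpExtension K p) (γ₁ γ₂ : absoluteGaloisGroup K) (k : ℕ),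
      ZpExtension.IsTopGeneratorPair κ₁ κ₂ γ₁ γ₂ ∧
      (∀ v : HeightOneSpectrum (𝓞 K), v ≠ 𝔭 → ∀ 𝔓 ∈ v.primesAbove,
        𝔓.inertia (absoluteGaloisGroup K) ≤ κ₁.kerSubgroup) ∧
      ZpExtension.pairKer κ₁ κ₂ ≤ κ.kerSubgroup ∧ γ₁ * γ⁻¹ ∈ κ.kerSubgroup ∧
      γ₂ * (γ ^ (p ^ k))⁻¹ ∈ κ.kerSubgroup := by
  have h0 : NumberField.Units.rank K = 0 := hK.unitsRank_eq_zero
  have h1 : NumberField.InfinitePlace.nrComplexPlaces K = 1 := hK.nrComplexPlaces_eq_one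
  -- (1) THE line unramified outside `𝔭`; it kills every inertia group above every `v ≠ 𝔭`
  obtain ⟨κ₀, hκ₀⟩ := ZpExtension.exists_isUnramifiedOutside_of_split (p := p) hK h𝔭 h𝔭' hne
  have hinert : ∀ v : HeightOneSpectrum (𝓞 K), v ≠ 𝔭 → ∀ 𝔓 ∈ v.primesAbove,
      𝔓.inertia (absoluteGaloisGroup K) ≤ κ₀.kerSubgroup := fun v hv 𝔓 h𝔓 ↦
    SplitPrimeLine.inertia_le_kerSubgroup_of_isUnramifiedOutside hκ₀ hv h𝔓
  -- (2) complete `κ₀` to a generator pair `(κ₀, κ₀'; δ₀, δ₀')`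
  obtain ⟨δ₀, hδ₀⟩ : ∃ δ₀ : absoluteGaloisGroup K, κ₀.IsTopGenerator δ₀ :=
    κ₀.surjective (Multiplicative.ofAdd 1)
  obtain ⟨κ₀', δ₀', hpair₀⟩ :=
    GeneratorPairSupply.exists_isTopGeneratorPair_of_isTopGenerator_of_isImaginaryQuadratic hK hδ₀
  -- (3) coordinates of `κ` on the pair
  obtain ⟨a, b, hab⟩ :=
    GeneratorPairSupply.exists_coeff_of_isTopGeneratorPair_of_isImaginaryQuadratic hK hpair₀
      κ.toContinuousMonoidHom
  simp only [ZpExtension.coe_toContinuousMonoidHom] at hab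
  have hκγ : (κ γ).toAdd = 1 := by
    rw [show κ γ = Multiplicative.ofAdd 1 from hγ, toAdd_ofAdd]
  -- (4) `b ≠ 0`: `κ` is ramified above `𝔭'` (Brink), `κ₀` is not
  have hb0 : b ≠ 0 := by
    obtain ⟨𝔓', h𝔓'⟩ := 𝔭'.primesAbove_nonempty
    obtain ⟨τ, hτ, hκτ⟩ :=
      ZpExtension.exists_mem_inertia_apply_ne_one_of_isAnticyclotomic hK hp2 κ hκ h𝔭' h𝔓'
    have hκ₀τ : κ₀ τ = 1 := ZpExtension.mem_kerSubgroup.mp (hinert 𝔭' hne 𝔓' h𝔓' hτ)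
    intro hb
    apply hκτ
    apply Multiplicative.toAdd.injective
    rw [hab τ, hκ₀τ, hb, toAdd_one, mul_zero, zero_mul, add_zero]
  by_cases hbu : IsUnit b
  · -- CASE `b ∈ ℤ_pˣ`: `κ₁ = κ₀`, `κ₂ = (a - 1) κ₀ + b κ₀' = κ - κ₀`, `k = 0`
    obtain ⟨ub, hub⟩ := hbu
    obtain ⟨γ₁, hγ₁, hγ₁'⟩ := TwoVariableSelmer.exists_apply_eq_of_isTopGeneratorPair hpair₀ 1
      (((ub⁻¹ : ℤ_[p]ˣ) : ℤ_[p]) * (1 - a))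
    obtain ⟨γ₂, hγ₂, hγ₂'⟩ := TwoVariableSelmer.exists_apply_eq_of_isTopGeneratorPair hpair₀ 0
      ((ub⁻¹ : ℤ_[p]ˣ) : ℤ_[p])
    have hb' : IsUnit (a - 1) ∨ IsUnit b := Or.inr ⟨ub, hub⟩
    have hpair : ZpExtension.IsTopGeneratorPair κ₀ (ZpExtension.ofLinComb hpair₀ (a - 1) b hb') γ₁ γ₂ := by
      refine ⟨hγ₁, ?_, ?_, ?_⟩
      · rw [ZpExtension.mem_kerSubgroup, ZpExtension.ofLinComb_apply, hγ₁, hγ₁', toAdd_ofAdd, toAdd_ofAdd,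
          ← hub, ← mul_assoc, Units.mul_inv, one_mul, mul_one, sub_add_sub_cancel, sub_self, ofAdd_zero]
      · rw [ZpExtension.mem_kerSubgroup, hγ₂, ofAdd_zero]
      · change ZpExtension.ofLinComb hpair₀ (a - 1) b hb' γ₂ = Multiplicative.ofAdd 1
        rw [ZpExtension.ofLinComb_apply, hγ₂, hγ₂', toAdd_ofAdd, toAdd_ofAdd, mul_zero, zero_add, ← hub,
          Units.mul_inv]
    refine ⟨κ₀, ZpExtension.ofLinComb hpair₀ (a - 1) b hb', γ₁, γ₂, 0, hpair, hinert,
      GeneratorPairSupply.pairKer_le_kerSubgroup h0 h1 hpair κ, ?_, ?_⟩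
    · rw [mul_inv_mem_kerSubgroup_iff, hab γ₁, hγ₁, hγ₁', toAdd_ofAdd, toAdd_ofAdd, hκγ, ← hub,
        ← mul_assoc, Units.mul_inv, one_mul, mul_one, add_sub_cancel]
    · rw [mul_inv_mem_kerSubgroup_iff, toAdd_apply_pow_of_isTopGenerator hγ, hab γ₂, hγ₂, hγ₂',
        toAdd_ofAdd, toAdd_ofAdd, mul_zero, zero_add, ← hub, Units.mul_inv, pow_zero]
  · -- CASE `b ∉ ℤ_pˣ`: then `a ∈ ℤ_pˣ`; `κ₁ = a κ₀`, `κ₂ = u κ₀'` with `b = u p^k`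
    have hau : IsUnit a := by
      have h1' : IsUnit (a * (κ₀ γ).toAdd + b * (κ₀' γ).toAdd) := by
        rw [← hab γ, hκγ]
        exact isUnit_one
      rcases IsLocalRing.isUnit_or_isUnit_of_isUnit_add h1' with h | h
      · exact isUnit_of_mul_isUnit_left h
      · exact absurd (isUnit_of_mul_isUnit_left h) hbu
    obtain ⟨ua, hua⟩ := hau
    set k : ℕ := b.valuation with hk
    set ub : ℤ_[p]ˣ := PadicInt.unitCoeff hb0 with hub_def
    have hb : b = (ub : ℤ_[p]) * (p : ℤ_[p]) ^ k := PadicInt.unitCoeff_spec hb0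
    obtain ⟨γ₁, hγ₁, hγ₁'⟩ := TwoVariableSelmer.exists_apply_eq_of_isTopGeneratorPair hpair₀
      ((ua⁻¹ : ℤ_[p]ˣ) : ℤ_[p]) 0
    obtain ⟨γ₂, hγ₂, hγ₂'⟩ := TwoVariableSelmer.exists_apply_eq_of_isTopGeneratorPair hpair₀ 0
      ((ub⁻¹ : ℤ_[p]ˣ) : ℤ_[p])
    have hpair : ZpExtension.IsTopGeneratorPair (κ₀.unitTwist ua) (κ₀'.unitTwist ub) γ₁ γ₂ := by
      refine ⟨?_, ?_, ?_, ?_⟩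
      · change κ₀.unitTwist ua γ₁ = Multiplicative.ofAdd 1
        rw [ZpExtension.unitTwist_apply, hγ₁, toAdd_ofAdd, Units.mul_inv]
      · rw [ZpExtension.mem_kerSubgroup, ZpExtension.unitTwist_apply, hγ₁', toAdd_ofAdd, mul_zero, ofAdd_zero]
      · rw [ZpExtension.mem_kerSubgroup, ZpExtension.unitTwist_apply, hγ₂, toAdd_ofAdd, mul_zero, ofAdd_zero]
      · change κ₀'.unitTwist ub γ₂ = Multiplicative.ofAdd 1
        rw [ZpExtension.unitTwist_apply, hγ₂', toAdd_ofAdd, Units.mul_inv]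
    refine ⟨κ₀.unitTwist ua, κ₀'.unitTwist ub, γ₁, γ₂, k, hpair, ?_,
      GeneratorPairSupply.pairKer_le_kerSubgroup h0 h1 hpair κ, ?_, ?_⟩
    · intro v hv 𝔓 h𝔓
      rw [ZpExtension.kerSubgroup_unitTwist]
      exact hinert v hv 𝔓 h𝔓
    · rw [mul_inv_mem_kerSubgroup_iff, hab γ₁, hγ₁, hγ₁', toAdd_ofAdd, toAdd_ofAdd, hκγ, ← hua, mul_zero,
        add_zero, Units.mul_inv]
    · rw [mul_inv_mem_kerSubgroup_iff, toAdd_apply_pow_of_isTopGenerator hγ, hab γ₂, hγ₂, hγ₂',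
        toAdd_ofAdd, toAdd_ofAdd, mul_zero, zero_add, hb, mul_assoc, mul_comm ((p : ℤ_[p]) ^ k),
        ← mul_assoc, Units.mul_inv, one_mul]

/-- **`stub_frame` of line `thin_comb` v2, closed** (verbatim the registered signature, `p = 3`): a 𝔭-adapted
normalised frame of the `ℤ₃²`-tower of an imaginary quadratic `K` with `3 = 𝔭𝔭′` split — generator pair
`(κ₁, κ₂; γ₁, γ₂)`, `κ₁` unramified outside `𝔭`, `ker κ₁ ∩ ker κ₂ ≤ ker κ`, `κ γ₁ = κ γ`, `κ γ₂ = κ γ^{3^k}`.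
[cite: deShalit1987, II.4.17 (p. 77)] [cite: Greenberg1978, §4 p. 94] [cite: Brink2007, Cor. 1 (p. 2136)] -/
theorem stub_frame :
    ∀ (K : Type) [Field K] [NumberField K], IsImaginaryQuadratic K →
    ∀ (κ : ZpExtension K 3), κ.IsAnticyclotomic → ∀ (γ : Field.absoluteGaloisGroup K), κ.IsTopGenerator γ →
    ∀ (𝔭 : HeightOneSpectrum (𝓞 K)), ((3 : ℕ) : 𝓞 K) ∈ 𝔭.asIdeal →
    ∀ (𝔭' : HeightOneSpectrum (𝓞 K)), ((3 : ℕ) : 𝓞 K) ∈ 𝔭'.asIdeal → 𝔭' ≠ 𝔭 →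
    ∃ (κ₁ κ₂ : ZpExtension K 3) (γ₁ γ₂ : Field.absoluteGaloisGroup K) (k : ℕ),
      ZpExtension.IsTopGeneratorPair κ₁ κ₂ γ₁ γ₂ ∧
      (∀ v : HeightOneSpectrum (𝓞 K), v ≠ 𝔭 → ∀ 𝔓 ∈ v.primesAbove,
        𝔓.inertia (Field.absoluteGaloisGroup K) ≤ κ₁.kerSubgroup) ∧
      ZpExtension.pairKer κ₁ κ₂ ≤ κ.kerSubgroup ∧ γ₁ * γ⁻¹ ∈ κ.kerSubgroup ∧
      γ₂ * (γ ^ (3 ^ k))⁻¹ ∈ κ.kerSubgroup :=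
  fun _K _ _ hK _κ hκ _γ hγ _𝔭 h𝔭 _𝔭' h𝔭' hne ↦
    exists_adaptedNormalisedFrame hK (by decide) hκ hγ h𝔭 h𝔭' hne

end Summit.BirchSwinnertonDyer.BirchSwinnertonDyer.Theorems.UniversalToricDescentThinCombLine

end
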